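import Mathlib
import HarnessLib
import Summits.Ventures.LatticeQCDFlow.Scaling.U1WilsonIdentityFlowKL
import Summits.Ventures.LatticeQCDFlow.Scaling.U1TorusIdentityFlowGeometricLaw
import Summits.Ventures.LatticeQCDFlow.Scaling.IdentityFlowStrictLaws

/-!
# LatticeQCDFlow / Scaling — the untrained U(1) Wilson sampler of the periodic torus in box
# coordinates is IMPERFECT (its reverse KL is `log Σₖ I_{|k|}(β)^V > 0`), so its Bhattacharyya
# ceiling is STRICT: `acc < (Σₖ I_{|k|}(β/2)^V)²/Σₖ I_{|k|}(β)^V`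

HONEST FRAMING: exact (Metropolis-corrected) sampling algorithms for lattice gauge theory;
figures of merit are autocorrelation/cost numbers at stated couplings and volumes; no
continuum-physics claim.

Venture `LatticeQCDFlow` (cell pub-lqcd), topic `Scaling`; FANOUT row 3 (`s0-u1-a`, S0-B
implementation A, GEN-14).  NEW WORK of the cell (elementary), the item left open by row 3's
`Scaling/U1WilsonIdentityFlowStrictFloor` (strictness of the CEILING in row 5's box coordinates):
row 3's reverse KL of the untrained torus sampler (`Scaling/U1WilsonIdentityFlowKL`, imported:
`D(Q‖P) = log Σₖ I_{|k|}(β)^V` for `L₁ > 1 ∨ L₂ > 1`) is POSITIVE for `β > 0` by row 3's sector-sum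
floor `Σₖ I_{|k|}(β)^V ≥ I₀(β)^V` (`Scaling/U1TorusIdentityFlowGeometricLaw`) and `I₀(β) > 1`
(`Scaling/U1IdentityFlowStrict`), so the Wilson density is not a.e. the Haar density on the box; by
row 3's bridge `not_hitOrMiss_ae_of_not_ae_eq` and strict Bhattacharyya ceiling
(`Scaling/IdentityFlowStrictLaws`, `Scaling/AcceptanceBhattacharyyaRigidityIntegral`) the ceiling of
GEN-13's torus sandwich is strict.  NO definition is introduced.

* `log_torusSum_pos` — the zero-training reverse KL `log Σₖ I_{|k|}(β)^V` is positive (`β > 0`);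
  **`u1TorusIdentityFlow_not_ae_eq`** — for `β > 0` and `L₁ > 1 ∨ L₂ > 1`, the normalised torus
  Wilson density is not a.e. equal to `(2π)^{−(n+1)}` on `(0, 2π]^{n+1}` (else the reverse KL
  would vanish);
* `u1TorusIdentityFlow_not_hitOrMiss` — hence the untrained torus sampler is graded;
* **`u1TorusIdentityFlow_essFrac_lt_one`** — `(Σₖ I_{|k|}(β)^V)² < Σₖ I_{|k|}(2β)^V`, i.e.
  `ESS_torus < 1` (row 3's `one_lt_integral_sq_div_iff`);
* **`u1TorusIdentityFlow_meanAccept_lt`** — `acc < (Σₖ I_{|k|}(β/2)^V)²/Σₖ I_{|k|}(β)^V` STRICTLY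
  (`V = L₁L₂`).

Reading (value-free): with `Scaling/U1WilsonIdentityFlowStrictFloor` both sides of GEN-13's torus
sandwich are strict for `β > 0` on every torus with a side of length `≥ 2`.  NOT CLAIMED: `β < 0`
(the sector sums alternate in sign; not needed by the cell); `L₁ = L₂ = 1`; any VALUE of ours;
nothing re-scored.
-/

noncomputable section

namespace Summit.Ventures.LatticeQCDFlow.Theory2

open MeasureTheory Real Set Finset
open Literature.Analysis.FunctionSpaces (besselI besselI_zero_pos)
open Summit.Ventures.LatticeQCDFlow.Scoring

section Torus

variable {L₁ L₂ : ℕ} [NeZero L₁] [NeZero L₂] {n : ℕ}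
  (e : Fin 2 × (Fin L₁ × Fin L₂) ≃ Fin (n + 1)) {β : ℝ}

omit [NeZero L₁] [NeZero L₂] in
/-- **The zero-training reverse KL of the torus sampler is positive**: `0 < log Σₖ I_{|k|}(β)^V` for
`β > 0` and `V = L₁L₂ ≥ 1` (`Σₖ I_{|k|}(β)^V ≥ I₀(β)^V > 1`). [ours] -/
theorem log_torusSum_pos (hV : 1 ≤ L₁ * L₂) (hβ : 0 < β) :
    0 < Real.log (∑' k : ℤ, besselI k.natAbs β ^ (L₁ * L₂)) :=
  Real.log_pos (lt_of_lt_of_le (one_lt_pow₀ (one_lt_besselI_zero hβ.ne') (by omega))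
    (besselI_zero_pow_le_torusSum hβ hV))

/-- **THE UNTRAINED TORUS SAMPLER IS IMPERFECT**: for `β > 0` and `L₁ > 1 ∨ L₂ > 1` the normalised
Wilson density `W/Z` is not a.e. the Haar density `(2π)^{−(n+1)}` on the box — otherwise the reverse
KL `log Σₖ I_{|k|}(β)^V` would be `0`, while `Σₖ I_{|k|}(β)^V ≥ I₀(β)^V > 1`. [ours] -/
theorem u1TorusIdentityFlow_not_ae_eq (hL : 1 < L₁ ∨ 1 < L₂) (hβ : 0 < β) :
    ¬ ((fun θ => u1WilsonWeight univ (torusInc e) (fun _ => β) θ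
          / u1WilsonZ univ (torusInc e) (fun _ => β))
        =ᵐ[volume.restrict (u1TorusBox (n + 1))] fun _ => (1 / (2 * π) ^ (n + 1) : ℝ)) := by
  intro h
  have hKL := u1TorusIdentityFlow_reverseKL e β hL
  have hzero : ∫ θ in u1TorusBox (n + 1), (1 / (2 * π) ^ (n + 1) : ℝ)
      * Real.log ((1 / (2 * π) ^ (n + 1))
        / (u1WilsonWeight univ (torusInc e) (fun _ => β) θ
          / u1WilsonZ univ (torusInc e) (fun _ => β))) = 0 := by
    have hae : (fun θ => (1 / (2 * π) ^ (n + 1) : ℝ)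
        * Real.log ((1 / (2 * π) ^ (n + 1))
          / (u1WilsonWeight univ (torusInc e) (fun _ => β) θ
            / u1WilsonZ univ (torusInc e) (fun _ => β))))
        =ᵐ[volume.restrict (u1TorusBox (n + 1))] fun _ => (0 : ℝ) := by
      filter_upwards [h] with θ hθ
      rw [hθ, div_self (by positivity : (1 / (2 * π) ^ (n + 1) : ℝ) ≠ 0), Real.log_one, mul_zero]
    rw [integral_congr_ae hae, integral_const, smul_zero]
  rw [hzero] at hKL
  -- `Σₖ I_{|k|}(β)^V ≥ I₀(β)^V > 1`, so its logarithm is positive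
  have hV : 1 ≤ L₁ * L₂ := Nat.one_le_iff_ne_zero.2 (mul_ne_zero (NeZero.ne L₁) (NeZero.ne L₂))
  have hlog := log_torusSum_pos (L₁ := L₁) (L₂ := L₂) hV hβ
  linarith

/-- **The untrained torus sampler is graded** (not hit-or-miss a.e.), `β > 0`, `L₁ > 1 ∨ L₂ > 1`.
[ours] -/
theorem u1TorusIdentityFlow_not_hitOrMiss (hL : 1 < L₁ ∨ 1 < L₂) (hβ : 0 < β) :
    ¬ ∃ c : ℝ, ∀ᵐ θ ∂(volume.restrict (u1TorusBox (n + 1))),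
      0 < u1WilsonWeight univ (torusInc e) (fun _ => β) θ / u1WilsonZ univ (torusInc e) (fun _ => β) →
        u1WilsonWeight univ (torusInc e) (fun _ => β) θ / u1WilsonZ univ (torusInc e) (fun _ => β)
          / (1 / (2 * π) ^ (n + 1)) = c :=
  not_hitOrMiss_ae_of_not_ae_eq
    (fun θ => div_pos (u1WilsonWeight_pos univ (torusInc e) (fun _ => β) θ)
      (u1WilsonZ_pos univ (torusInc e) (fun _ => β)))
    (integral_u1WilsonD univ (torusInc e) (fun _ => β)) (fun _ => by positivity) integral_u1HaarD
    (u1TorusIdentityFlow_not_ae_eq e hL hβ)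

/-- **`ESS_torus < 1`**: `(Σₖ I_{|k|}(β)^V)² < Σₖ I_{|k|}(2β)^V` for `β > 0`, `L₁ > 1 ∨ L₂ > 1` — the
Kish effective-sample-size fraction of the untrained torus sampler is strictly below one (row 3's
`one_lt_integral_sq_div_iff`: `ESS < 1` iff the flow is imperfect). [ours] -/
theorem u1TorusIdentityFlow_essFrac_lt_one (hL : 1 < L₁ ∨ 1 < L₂) (hβ : 0 < β) :
    (∑' k : ℤ, besselI k.natAbs β ^ (L₁ * L₂)) ^ 2
        / ∑' k : ℤ, besselI k.natAbs (2 * β) ^ (L₁ * L₂) < 1 := by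
  -- a labelling of the `2·L₁·L₂` links by `Fin (n + 1)`
  obtain ⟨n, hn⟩ : ∃ n, Fintype.card (Fin 2 × (Fin L₁ × Fin L₂)) = n + 1 :=
    Nat.exists_eq_add_one_of_ne_zero Fintype.card_ne_zero
  let e : Fin 2 × (Fin L₁ × Fin L₂) ≃ Fin (n + 1) := (Fintype.equivFin _).trans (finCongr hn)
  set μ : Measure (Fin (n + 1) → ℝ) := volume.restrict (u1TorusBox (n + 1)) with hμ
  have hess := u1TorusIdentityFlow_essFrac e β
  rw [integral_u1WilsonD, one_pow] at hess
  have hq0 : ∀ _θ : Fin (n + 1) → ℝ, (0 : ℝ) < 1 / (2 * π) ^ (n + 1) := fun _ => by positivity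
  have hqi : Integrable (fun _ : Fin (n + 1) → ℝ => (1 / (2 * π) ^ (n + 1) : ℝ)) μ := by
    haveI := isFiniteMeasure_volume_restrict_u1TorusBox (n + 1)
    exact integrable_const _
  have hWc : Continuous fun θ => (u1WilsonWeight univ (torusInc e) (fun _ => β) θ
      / u1WilsonZ univ (torusInc e) (fun _ => β)) ^ 2 / (1 / (2 * π) ^ (n + 1)) :=
    (((continuous_u1WilsonWeight univ (torusInc e) (fun _ => β)).div_const _).pow 2).div_const _
  have hW : Integrable (fun θ => (u1WilsonWeight univ (torusInc e) (fun _ => β) θ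
      / u1WilsonZ univ (torusInc e) (fun _ => β)) ^ 2 / (1 / (2 * π) ^ (n + 1))) μ :=
    integrableOn_u1TorusBox hWc
  have h1 := (one_lt_integral_sq_div_iff (μ := μ) (integrable_u1WilsonD univ (torusInc e) (fun _ => β))
    (integral_u1WilsonD univ (torusInc e) (fun _ => β)) hq0 hqi integral_u1HaarD hW).2
    (u1TorusIdentityFlow_not_ae_eq e hL hβ)
  rw [← hess, div_lt_one (lt_trans one_pos h1)]
  exact h1

/-- **STRICT BHATTACHARYYA CEILING ON THE TORUS (box coordinates)**: for `β > 0` and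
`L₁ > 1 ∨ L₂ > 1`, `acc < (Σₖ I_{|k|}(β/2)^V)²/Σₖ I_{|k|}(β)^V`, `V = L₁L₂`. [ours] -/
theorem u1TorusIdentityFlow_meanAccept_lt (hL : 1 < L₁ ∨ 1 < L₂) (hβ : 0 < β) :
    ∫ θ in u1TorusBox (n + 1), ∫ θ' in u1TorusBox (n + 1),
        min (u1WilsonWeight univ (torusInc e) (fun _ => β) θ
              / u1WilsonZ univ (torusInc e) (fun _ => β) * (1 / (2 * π) ^ (n + 1)))
          (u1WilsonWeight univ (torusInc e) (fun _ => β) θ'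
              / u1WilsonZ univ (torusInc e) (fun _ => β) * (1 / (2 * π) ^ (n + 1)))
      < (∑' k : ℤ, besselI k.natAbs (β / 2) ^ (L₁ * L₂)) ^ 2
          / ∑' k : ℤ, besselI k.natAbs β ^ (L₁ * L₂) := by
  set μ : Measure (Fin (n + 1) → ℝ) := volume.restrict (u1TorusBox (n + 1)) with hμ
  have hZ := u1WilsonZ_pos univ (torusInc e) (fun _ => β)
  have hc : (0 : ℝ) < (2 * π) ^ (n + 1) := by positivity
  have hw0 := u1WilsonWeight_pos univ (torusInc e) (fun _ => β)
  have hq0 : ∀ _θ : Fin (n + 1) → ℝ, (0 : ℝ) < 1 / (2 * π) ^ (n + 1) := fun _ => by positivity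
  have hqm : Measurable fun _ : Fin (n + 1) → ℝ => (1 / (2 * π) ^ (n + 1) : ℝ) := measurable_const
  have hqi : Integrable (fun _ : Fin (n + 1) → ℝ => (1 / (2 * π) ^ (n + 1) : ℝ)) μ := by
    haveI := isFiniteMeasure_volume_restrict_u1TorusBox (n + 1)
    exact integrable_const _
  have h := meanAccept_lt_sq_integral_sqrt (μ := μ) (fun θ => (div_pos (hw0 θ) hZ).le)
    (measurable_u1WilsonD univ (torusInc e) (fun _ => β))
    (integrable_u1WilsonD univ (torusInc e) (fun _ => β))
    (integral_u1WilsonD univ (torusInc e) (fun _ => β)) hq0 hqm hqi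
    (u1TorusIdentityFlow_not_hitOrMiss e hL hβ)
  rw [hμ, integral_sqrt_u1WilsonD_mul, div_pow, Real.sq_sqrt (mul_pos hc hZ).le] at h
  have hS : ∀ A B : ℝ, ((2 * π) ^ (n + 1) * A) ^ 2 / ((2 * π) ^ (n + 1) * ((2 * π) ^ (n + 1) * B))
      = A ^ 2 / B := fun A B => by
    rw [mul_pow, ← mul_assoc, ← sq, mul_div_mul_left _ _ (pow_ne_zero 2 hc.ne')]
  calc _ < u1WilsonZ univ (torusInc e) (fun _ => β / 2) ^ 2
          / ((2 * π) ^ (n + 1) * u1WilsonZ univ (torusInc e) (fun _ => β)) := h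
    _ = (∑' k : ℤ, besselI k.natAbs (β / 2) ^ (L₁ * L₂)) ^ 2
          / ∑' k : ℤ, besselI k.natAbs β ^ (L₁ * L₂) := by
        rw [torus_u1WilsonZ_uniform e (β / 2), torus_u1WilsonZ_uniform e β, hS]

end Torus

end Summit.Ventures.LatticeQCDFlow.Theory2
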